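import Mathlib
import Summits.ABC.ABC.Theses.GvfSupportTransfer

/-!
# Birth skeleton (BC3) of split piece `GenericLawTransfer` (child of crux `LinearLawTransfer`, stmt-ABC-11084)

Line "generic density": the route's own mechanism (genus-negligible density ⇒ law transfer) pushed through the
exceptional-curve split. Two registered stubs and the kernel-checked composition `GenericLawTransfer_of`.
Sorries live ONLY inside `stub_*`.
-/

set_option linter.dupNamespace false

namespace Summit.ABC.ABC.Cruxes.LinearLawTransfer.Split

open scoped BigOperators
open Literature.NumberTheory.DiophantineGeometry

/-- Split piece X₁ (crux, open): LINEAR LAW TRANSFER OFF AN EXCEPTIONAL CURVE (verbatim the child statement). -/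
def GenericLawTransfer : Prop :=
  ∀ (m n : ℕ) (T : Fin m → Fin (n + 1) → MvPolynomial (Fin 2) ℤ) (c : Fin m → ℝ) (C : ℝ), (∀ (F : Type) [Field F] [Algebra ℂ F], Algebra.trdeg ℂ F = 1 → (⊤ : IntermediateField ℂ F).FG → ∀ g : ℕ, (∀ D : Literature.NumberTheory.DiophantineGeometry.AlgFunctionField.Divisor ℂ F, D.degree + 1 - (Literature.NumberTheory.DiophantineGeometry.AlgFunctionField.ell D : ℤ) ≤ g) → ∀ ξ η : F, (∀ j i, MvPolynomial.aeval ![ξ, η] (T j i) ≠ 0) → ∑ j, c j * ∑ᶠ v : Literature.NumberTheory.DiophantineGeometry.AlgFunctionField.PlaceOver ℂ F, ((v.degree : ℝ) * ⨆ i, (-(v.ord (MvPolynomial.aeval ![ξ, η] (T j i))) : ℝ)) ≤ C * max 0 (2 * (g : ℝ) - 2)) → ∀ δ : ℝ, 0 < δ → ∃ G : MvPolynomial (Fin 2) ℤ, G ≠ 0 ∧ ∃ H₀ : ℝ, ∀ x y : ℚ, (∀ j i, MvPolynomial.aeval ![x, y] (T j i) ≠ 0) → MvPolynomial.aeval ![x,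 y] G ≠ 0 → H₀ ≤ Height.logHeight ![(1 : ℚ), x, y] → ∑ j, c j * Height.logHeight (fun i => MvPolynomial.aeval ![x, y] (T j i)) ≤ δ * Height.logHeight ![(1 : ℚ), x, y]

/-- **stub 1 — GENERIC GENUS-NEGLIGIBLE DENSITY** (the route's rank-2 crux `GenusNegligibleDensity` weakened by
an exceptional curve: implied by it with `G = 1`, and the natural output of a positivity / BDPP-type density
argument, which produces approximating curves only for points in general position). For every finite family of
integer polynomial tuples `T` and `ε > 0` there are a nonzero `G ∈ ℤ[X,Y]` and `H₀` such that every rational pair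
off the curves `T_ji = 0`, off `G = 0` and of height `L ≥ H₀` is shadowed by a pair `(ξ,η)` in a complex function
field of one variable with genus bound `g`, at a scale `σ > 0` with `σ(2g−2) ≤ εL`, up to `εL` on every `h(T_j)`.
Load-bearing: this is where rationality and genus-negligibility enter. -/
theorem stub_genericDensity :
    ∀ (m n : ℕ) (T : Fin m → Fin (n + 1) → MvPolynomial (Fin 2) ℤ) (ε : ℝ), 0 < ε →
      ∃ G : MvPolynomial (Fin 2) ℤ, G ≠ 0 ∧ ∃ H₀ : ℝ, ∀ x y : ℚ,
        (∀ j i, MvPolynomial.aeval ![x, y] (T j i) ≠ 0) → MvPolynomial.aeval ![x, y] G ≠ 0 →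
        H₀ ≤ Height.logHeight ![(1 : ℚ), x, y] →
        ∃ (F : Type) (_ : Field F) (_ : Algebra ℂ F) (g : ℕ) (ξ η : F) (σ : ℝ),
          Algebra.trdeg ℂ F = 1 ∧ (⊤ : IntermediateField ℂ F).FG ∧
          (∀ D : AlgFunctionField.Divisor ℂ F, D.degree + 1 - (AlgFunctionField.ell D : ℤ) ≤ g) ∧
          0 < σ ∧ σ * (2 * (g : ℝ) - 2) ≤ ε * Height.logHeight ![(1 : ℚ), x, y] ∧
          (∀ j i, MvPolynomial.aeval ![ξ, η] (T j i) ≠ 0) ∧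
          ∀ j, |Height.logHeight (fun i => MvPolynomial.aeval ![x, y] (T j i)) -
              σ * ∑ᶠ v : AlgFunctionField.PlaceOver ℂ F,
                ((v.degree : ℝ) * ⨆ i, (-(v.ord (MvPolynomial.aeval ![ξ, η] (T j i))) : ℝ))|
            ≤ ε * Height.logHeight ![(1 : ℚ), x, y] := by
  sorry

/-- **stub 2 — A SHADOW TRANSFERS EVERY VALID LINEAR LAW** (pointwise bookkeeping, provable: finite sums and
`|·|` over `ℝ`; the content of the route's support item `DensityImpliesLawTransfer`, stated per point so that it
serves the generic split). If `(T, c, C)` is a law valid on complex function fields and `(F, g, ξ, η, σ)` shadows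
the rational pair `(x, y)` at precision `ε ≥ 0`, then `Σ_j c_j h(T_j(x,y)) ≤ (max C 0 + Σ_j |c_j|)·ε·h(1:x:y)`:
`Σ c_j h_j = Σ c_j (h_j − σ f_j) + σ Σ c_j f_j ≤ (Σ|c_j|) εL + σ·C·max(0,2g−2)` and
`σ·C·max(0,2g−2) ≤ max C 0 · max(0, σ(2g−2)) ≤ max C 0 · εL`. -/
theorem stub_shadowTransfersLaw :
    ∀ (m n : ℕ) (T : Fin m → Fin (n + 1) → MvPolynomial (Fin 2) ℤ) (c : Fin m → ℝ) (C : ℝ),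
      (∀ (F : Type) [Field F] [Algebra ℂ F], Algebra.trdeg ℂ F = 1 → (⊤ : IntermediateField ℂ F).FG →
        ∀ g : ℕ, (∀ D : AlgFunctionField.Divisor ℂ F, D.degree + 1 - (AlgFunctionField.ell D : ℤ) ≤ g) →
        ∀ ξ η : F, (∀ j i, MvPolynomial.aeval ![ξ, η] (T j i) ≠ 0) →
        ∑ j, c j * ∑ᶠ v : AlgFunctionField.PlaceOver ℂ F,
          ((v.degree : ℝ) * ⨆ i, (-(v.ord (MvPolynomial.aeval ![ξ, η] (T j i))) : ℝ)) ≤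
          C * max 0 (2 * (g : ℝ) - 2)) →
      ∀ (ε : ℝ), 0 ≤ ε → ∀ (x y : ℚ) (F : Type) [Field F] [Algebra ℂ F] (g : ℕ) (ξ η : F) (σ : ℝ),
        Algebra.trdeg ℂ F = 1 → (⊤ : IntermediateField ℂ F).FG →
        (∀ D : AlgFunctionField.Divisor ℂ F, D.degree + 1 - (AlgFunctionField.ell D : ℤ) ≤ g) →
        0 < σ → σ * (2 * (g : ℝ) - 2) ≤ ε * Height.logHeight ![(1 : ℚ), x, y] →
        (∀ j i, MvPolynomial.aeval ![ξ, η] (T j i) ≠ 0) →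
        (∀ j, |Height.logHeight (fun i => MvPolynomial.aeval ![x, y] (T j i)) -
              σ * ∑ᶠ v : AlgFunctionField.PlaceOver ℂ F,
                ((v.degree : ℝ) * ⨆ i, (-(v.ord (MvPolynomial.aeval ![ξ, η] (T j i))) : ℝ))|
            ≤ ε * Height.logHeight ![(1 : ℚ), x, y]) →
        ∑ j, c j * Height.logHeight (fun i => MvPolynomial.aeval ![x, y] (T j i)) ≤
          (max C 0 + ∑ j, |c j|) * ε * Height.logHeight ![(1 : ℚ), x, y] := by
  sorry

/-- **Composition (kernel-checked, no sorry): `stub_genericDensity → stub_shadowTransfersLaw → GenericLawTransfer`.**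
Given a valid law `(T, c, C)` and `δ > 0`, put `A := max C 0 + Σ|c_j|`, `ε := δ/(A+1)`; stub 1 at precision `ε`
yields the exceptional `G` and a threshold `H₀`; at a rational pair off `T`, off `G`, of height `≥ max H₀ 0`,
stub 2 applied to the shadow gives `Σ c_j h(T_j) ≤ A·ε·L ≤ δ·L`. [folklore] -/
theorem GenericLawTransfer_of :
    (∀ (m n : ℕ) (T : Fin m → Fin (n + 1) → MvPolynomial (Fin 2) ℤ) (ε : ℝ), 0 < ε →
      ∃ G : MvPolynomial (Fin 2) ℤ, G ≠ 0 ∧ ∃ H₀ : ℝ, ∀ x y : ℚ,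
        (∀ j i, MvPolynomial.aeval ![x, y] (T j i) ≠ 0) → MvPolynomial.aeval ![x, y] G ≠ 0 →
        H₀ ≤ Height.logHeight ![(1 : ℚ), x, y] →
        ∃ (F : Type) (_ : Field F) (_ : Algebra ℂ F) (g : ℕ) (ξ η : F) (σ : ℝ),
          Algebra.trdeg ℂ F = 1 ∧ (⊤ : IntermediateField ℂ F).FG ∧
          (∀ D : AlgFunctionField.Divisor ℂ F, D.degree + 1 - (AlgFunctionField.ell D : ℤ) ≤ g) ∧
          0 < σ ∧ σ * (2 * (g : ℝ) - 2) ≤ ε * Height.logHeight ![(1 : ℚ), x, y] ∧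
          (∀ j i, MvPolynomial.aeval ![ξ, η] (T j i) ≠ 0) ∧
          ∀ j, |Height.logHeight (fun i => MvPolynomial.aeval ![x, y] (T j i)) -
              σ * ∑ᶠ v : AlgFunctionField.PlaceOver ℂ F,
                ((v.degree : ℝ) * ⨆ i, (-(v.ord (MvPolynomial.aeval ![ξ, η] (T j i))) : ℝ))|
            ≤ ε * Height.logHeight ![(1 : ℚ), x, y]) →
    (∀ (m n : ℕ) (T : Fin m → Fin (n + 1) → MvPolynomial (Fin 2) ℤ) (c : Fin m → ℝ) (C : ℝ),
      (∀ (F : Type) [Field F] [Algebra ℂ F], Algebra.trdeg ℂ F = 1 → (⊤ : IntermediateField ℂ F).FG →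
        ∀ g : ℕ, (∀ D : AlgFunctionField.Divisor ℂ F, D.degree + 1 - (AlgFunctionField.ell D : ℤ) ≤ g) →
        ∀ ξ η : F, (∀ j i, MvPolynomial.aeval ![ξ, η] (T j i) ≠ 0) →
        ∑ j, c j * ∑ᶠ v : AlgFunctionField.PlaceOver ℂ F,
          ((v.degree : ℝ) * ⨆ i, (-(v.ord (MvPolynomial.aeval ![ξ, η] (T j i))) : ℝ)) ≤
          C * max 0 (2 * (g : ℝ) - 2)) →
      ∀ (ε : ℝ), 0 ≤ ε → ∀ (x y : ℚ) (F : Type) [Field F] [Algebra ℂ F] (g : ℕ) (ξ η : F) (σ : ℝ),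
        Algebra.trdeg ℂ F = 1 → (⊤ : IntermediateField ℂ F).FG →
        (∀ D : AlgFunctionField.Divisor ℂ F, D.degree + 1 - (AlgFunctionField.ell D : ℤ) ≤ g) →
        0 < σ → σ * (2 * (g : ℝ) - 2) ≤ ε * Height.logHeight ![(1 : ℚ), x, y] →
        (∀ j i, MvPolynomial.aeval ![ξ, η] (T j i) ≠ 0) →
        (∀ j, |Height.logHeight (fun i => MvPolynomial.aeval ![x, y] (T j i)) -
              σ * ∑ᶠ v : AlgFunctionField.PlaceOver ℂ F,
                ((v.degree : ℝ) * ⨆ i, (-(v.ord (MvPolynomial.aeval ![ξ, η] (T j i))) : ℝ))|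
            ≤ ε * Height.logHeight ![(1 : ℚ), x, y]) →
        ∑ j, c j * Height.logHeight (fun i => MvPolynomial.aeval ![x, y] (T j i)) ≤
          (max C 0 + ∑ j, |c j|) * ε * Height.logHeight ![(1 : ℚ), x, y]) →
    GenericLawTransfer := by
  intro h1 h2 m n T c C hlaw δ hδ
  set A : ℝ := max C 0 + ∑ j, |c j| with hA
  have hA0 : 0 ≤ A := add_nonneg (le_max_right _ _) (Finset.sum_nonneg fun j _ => abs_nonneg _)
  have hA1 : 0 < A + 1 := by linarith
  set ε : ℝ := δ / (A + 1) with hε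
  have hε0 : 0 < ε := div_pos hδ hA1
  have hAε : A * ε ≤ δ := by
    rw [hε, mul_div_assoc', div_le_iff₀ hA1]
    nlinarith
  obtain ⟨G, hG, H₀, hH⟩ := h1 m n T ε hε0
  refine ⟨G, hG, max H₀ 0, fun x y hT hGxy hh => ?_⟩
  have hH0 : H₀ ≤ Height.logHeight ![(1 : ℚ), x, y] := (le_max_left _ _).trans hh
  have hL0 : 0 ≤ Height.logHeight ![(1 : ℚ), x, y] := (le_max_right _ _).trans hh
  obtain ⟨F, instF, instA, g, ξ, η, σ, htr, hfg, hgen, hσ, hσg, hne, happ⟩ := hH x y hT hGxy hH0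
  have key := @h2 m n T c C hlaw ε hε0.le x y F instF instA g ξ η σ htr hfg hgen hσ hσg hne happ
  calc ∑ j, c j * Height.logHeight (fun i => MvPolynomial.aeval ![x, y] (T j i))
      ≤ (max C 0 + ∑ j, |c j|) * ε * Height.logHeight ![(1 : ℚ), x, y] := key
    _ = (A * ε) * Height.logHeight ![(1 : ℚ), x, y] := by rw [hA]
    _ ≤ δ * Height.logHeight ![(1 : ℚ), x, y] := mul_le_mul_of_nonneg_right hAε hL0

end Summit.ABC.ABC.Cruxes.LinearLawTransfer.Split
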